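/-
Copyright (c) 2026. All rights reserved.
Released under Apache 2.0 license as described in the file LICENSE.
-/
import Literature.NumberTheory.PAdicHodge.SenRelativeDecompletion
import Literature.NumberTheory.PAdicHodge.SenDecompletionUnique
import HarnessLib

/-!
# Sen's uniqueness lemma, the a-priori bound and the decompletion of a whole cocycle over an abstract
# Tate–Sen datum (Berger–Colmez, Lemme 3.2.5 and Prop. 3.2.6 for a general closed subfield `A ⊆ ℂ_F`)

`SenDecompletionUnique` / `SenDecompletionCocycle` prove Berger–Colmez Lemme 3.2.5 and Prop. 3.2.6 over
the completed cyclotomic field `X = ℂ_F^{H₀}` with Tate's trace `R_n` and `γ = γ_n`. Here the SAME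
arguments are run over an abstract Tate–Sen datum, given as explicit hypotheses: a subfield `A ⊆ ℂ_F`,
`γ ∈ G₀` with `γA ⊆ A`, and `R : ℂ_F → ℂ_F` which on `A` is a `γ`-invariant additive idempotent with values
in `A`, LINEAR over the `γ`-invariants of `A` (`R(a x) = a R(x)` for `γ a = a`), with `R ∘ γ = R`, (TS2)
`‖R x‖ ≤ c₂‖x‖`, (TS3) `‖x − R x‖ ≤ c₃‖γx − x‖` and Tate's surjectivity — exactly the package delivered
for `A = X_N = ℂ_F^{H_N}` by `TateTrace.exists_relTatePackage`.

## Main results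

* `TateTrace.map_mul_mul_apply_subfield` — `R((V₁ B V₂)_{ij}) = (V₁ R(B) V₂)_{ij}` for `γ`-fixed
  `V₁, V₂ ∈ M_d(A)`.
* ★ `TateTrace.matrix_smul_eq_of_map_eq_mul_mul_subfield` — **Berger–Colmez Lemme 3.2.5**: `B ∈ M_d(A)`,
  `V₁, V₂ ∈ M_d(A)^{γ=1}` with `‖Vᵢ − 1‖ ≤ r`, `r < 1`, `c₃ r < 1`, and `γ(B) = V₁ B V₂` ⟹ `γ` fixes `B`.
* ★ `TateTrace.matrix_smul_eq_of_map_eq_inv_mul_map_subfield` — **propagation** along an element `τ`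
  with `τA ⊆ A` commuting with `γ` on `A`: `W ∈ M_d(A)^{γ=1}`, `‖W − 1‖ ≤ r`, `γ(V) = W⁻¹ V τ(W)` ⟹ `γ`
  fixes `V`.
* `TateTrace.norm_fixed_conj_sub_one_le_subfield` — **the a-priori bound**: `B W = U γ(B)` with `W`
  `γ`-fixed, `‖B − 1‖ ≤ d ≤ 1`, `c₂ d < 1`, `‖U − 1‖ ≤ u` ⟹ `‖W − 1‖ ≤ c₂ u`.
* ★★ `TateTrace.exists_matrix_conj_fixed_forall_subfield` — **Berger–Colmez Prop. 3.2.6 over the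
  datum** (`c₂ = ‖p‖^{-k₂}`, `c₃ = ‖p‖^{-k₃}`): for `U_γ ∈ M_d(A)` with `‖U_γ − 1‖ ≤ ‖p‖^{2k₂+2k₃+1}`
  there is `B ∈ GL_d(A)`, `‖B − 1‖ ≤ ‖p‖^{k₂+1}`, with `B⁻¹ U_γ γ(B)` fixed by `γ` and
  `‖B⁻¹ U_γ γ(B) − 1‖ ≤ ‖p‖^{k₂+2k₃+1}`, such that for every `τ` (`τA ⊆ A`, `γτ = τγ` on `A`) and every
  `U_τ ∈ M_d(A)` with `U_γ γ(U_τ) = U_τ τ(U_γ)` the matrix `B⁻¹ U_τ τ(B)` is fixed by `γ` as well.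

No named facts are used.

References: L. Berger, P. Colmez, Astérisque 319 (2008), Déf. 3.1.3, Lemme 3.2.5, Prop. 3.2.6
[BergerColmez2008]; J. Tate, *p-divisible groups* (1967), §3.2 Prop. 7 [Tate1967]; S. Sen, *Continuous
cohomology and p-adic Galois representations*, Invent. Math. 62 (1980), Theorem 3 [Sen1980].
-/

noncomputable section

open ValuativeRel Field UniformSpace Filter Topology Finset

open scoped IntermediateField

namespace Literature.NumberTheory.PAdicHodge

open Literature.NumberTheory.GaloisRepresentations
open Literature.NumberTheory.GaloisRepresentations.IsNonarchimedeanLocalField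
open CyclotomicTower

variable {F : Type} [Field F] [ValuativeRel F] [TopologicalSpace F] [IsNonarchimedeanLocalField F]
  [CharZero F] {p : ℕ} [Fact p.Prime] (hp : valuation F p < 1)

namespace TateTrace

variable {m : Type} [Fintype m] [DecidableEq m]

/-! ### Ultrametric matrix toolkit over `ℂ_F` (as in `SenDecompletionMatrix`) -/

omit [CharZero F] in
/-- `‖x + y‖ ≤ max ‖x‖ ‖y‖` in `ℂ_F`. [folklore] -/
private theorem norm_add_le_max' (x y : CompletedAlgClosure F) : ‖x + y‖ ≤ max ‖x‖ ‖y‖ :=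
  IsUltrametricDist.norm_add_le_max x y

omit [CharZero F] in
/-- `‖x - y‖ ≤ max ‖x‖ ‖y‖` in `ℂ_F`. [folklore] -/
private theorem norm_sub_le_max' (x y : CompletedAlgClosure F) : ‖x - y‖ ≤ max ‖x‖ ‖y‖ := by
  rw [sub_eq_add_neg, ← norm_neg y]; exact IsUltrametricDist.norm_add_le_max x (-y)

omit [CharZero F] in
/-- `‖1 + c‖ = 1` when `‖c‖ < 1`. [folklore] -/
private theorem norm_one_add_eq {c : CompletedAlgClosure F} (hc : ‖c‖ < 1) : ‖1 + c‖ = 1 := by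
  have h := IsUltrametricDist.norm_add_eq_max_of_norm_ne_norm (x := (1 : CompletedAlgClosure F)) (y := c)
    (by rw [norm_one]; exact hc.ne')
  rw [h, norm_one, max_eq_left hc.le]

omit [CharZero F] [DecidableEq m] in
/-- Entrywise bounds are submultiplicative over the ultrametric field `ℂ_F`. [folklore] -/
private theorem norm_mul_apply_le {A B : Matrix m m (CompletedAlgClosure F)} {a b : ℝ} (ha : 0 ≤ a)
    (hb : 0 ≤ b) (hA : ∀ i j, ‖A i j‖ ≤ a) (hB : ∀ i j, ‖B i j‖ ≤ b) (i j : m) :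
    ‖(A * B) i j‖ ≤ a * b := by
  rw [Matrix.mul_apply]
  exact IsUltrametricDist.norm_sum_le_of_forall_le_of_nonneg (mul_nonneg ha hb)
    fun k _ => by rw [norm_mul]; exact mul_le_mul (hA i k) (hB k j) (norm_nonneg _) ha

omit [CharZero F] [Fintype m] [DecidableEq m] in
/-- `‖(A - B) i j‖ ≤ max`. [folklore] -/
private theorem norm_sub_apply_le {A B : Matrix m m (CompletedAlgClosure F)} {a b : ℝ}
    (hA : ∀ i j, ‖A i j‖ ≤ a) (hB : ∀ i j, ‖B i j‖ ≤ b) (i j : m) :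
    ‖(A - B) i j‖ ≤ max a b := by
  rw [Matrix.sub_apply]
  exact (norm_sub_le_max' _ _).trans (max_le_max (hA i j) (hB i j))

omit [CharZero F] [Fintype m] [DecidableEq m] in
/-- `‖(A + B) i j‖ ≤ max`. [folklore] -/
private theorem norm_add_apply_le {A B : Matrix m m (CompletedAlgClosure F)} {a b : ℝ}
    (hA : ∀ i j, ‖A i j‖ ≤ a) (hB : ∀ i j, ‖B i j‖ ≤ b) (i j : m) :
    ‖(A + B) i j‖ ≤ max a b := by
  rw [Matrix.add_apply]
  exact (norm_add_le_max' _ _).trans (max_le_max (hA i j) (hB i j))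

omit [CharZero F] in
/-- The determinant of a matrix with entries of norm `≤ 1` has norm `≤ 1`. [folklore] -/
private theorem norm_det_le_one {A : Matrix m m (CompletedAlgClosure F)} (hA : ∀ i j, ‖A i j‖ ≤ 1) :
    ‖A.det‖ ≤ 1 := by
  rw [Matrix.det_apply']
  refine IsUltrametricDist.norm_sum_le_of_forall_le_of_nonneg zero_le_one fun σ _ => ?_
  have h1 : ‖(((Equiv.Perm.sign σ : ℤˣ) : ℤ) : CompletedAlgClosure F)‖ = 1 := by
    rcases Int.units_eq_one_or (Equiv.Perm.sign σ) with h | h <;> simp [h]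
  rw [norm_mul, h1, one_mul, norm_prod]
  exact Finset.prod_le_one (fun i _ => norm_nonneg _) fun i _ => hA _ _

omit [CharZero F] [Fintype m] in
/-- Entries of `1 + C`, `‖C‖ ≤ r ≤ 1`: norm `≤ 1`, and the off-diagonal ones `≤ r`. [folklore] -/
private theorem norm_one_add_apply_le {C : Matrix m m (CompletedAlgClosure F)} {r : ℝ} (hr1 : r ≤ 1)
    (hC : ∀ i j, ‖C i j‖ ≤ r) (i j : m) :
    ‖(1 + C : Matrix m m (CompletedAlgClosure F)) i j‖ ≤ 1 ∧
      (i ≠ j → ‖(1 + C : Matrix m m (CompletedAlgClosure F)) i j‖ ≤ r) := by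
  rw [Matrix.add_apply]
  by_cases hij : i = j
  · subst hij
    rw [Matrix.one_apply_eq]
    refine ⟨(norm_add_le_max' _ _).trans ?_, fun h => (h rfl).elim⟩
    rw [norm_one]; exact max_le le_rfl ((hC i i).trans hr1)
  · rw [Matrix.one_apply_ne hij, zero_add]
    exact ⟨(hC i j).trans hr1, fun _ => hC i j⟩

omit [CharZero F] [Fintype m] in
/-- `‖∏ (1 + c_i) − 1‖ ≤ r` when all `‖c_i‖ ≤ r ≤ 1`. [folklore] -/
private theorem norm_prod_one_add_sub_one_le {s : Finset m} {c : m → CompletedAlgClosure F} {r : ℝ}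
    (hr0 : 0 ≤ r) (hr1 : r ≤ 1) (hc : ∀ i, ‖c i‖ ≤ r) : ‖∏ i ∈ s, (1 + c i) - 1‖ ≤ r := by
  induction s using Finset.induction_on with
  | empty => rw [Finset.prod_empty, sub_self, norm_zero]; exact hr0
  | @insert a s ha ih =>
    rw [Finset.prod_insert ha]
    set P := ∏ i ∈ s, (1 + c i)
    have hP : ‖P‖ ≤ 1 := by
      have h := norm_add_le_max' (P - 1) 1
      rw [sub_add_cancel, norm_one] at h
      exact h.trans (max_le (ih.trans hr1) le_rfl)
    have h : (1 + c a) * P - 1 = (P - 1) + c a * P := by ring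
    rw [h]
    refine (norm_add_le_max' _ _).trans (max_le ih ?_)
    rw [norm_mul]
    calc ‖c a‖ * ‖P‖ ≤ r * 1 := mul_le_mul (hc a) hP (norm_nonneg _) hr0
      _ = r := mul_one r

omit [CharZero F] in
/-- `‖det(1 + C) − 1‖ ≤ ‖C‖` for `‖C‖ < 1` (Leibniz expansion). [folklore] -/
private theorem norm_det_one_add_sub_one_le {C : Matrix m m (CompletedAlgClosure F)} {r : ℝ}
    (hr0 : 0 ≤ r) (hr1 : r < 1) (hC : ∀ i j, ‖C i j‖ ≤ r) :
    ‖(1 + C : Matrix m m (CompletedAlgClosure F)).det - 1‖ ≤ r := by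
  have hent := norm_one_add_apply_le hr1.le hC
  rw [Matrix.det_apply', ← Finset.sum_erase_add _ _ (Finset.mem_univ (1 : Equiv.Perm m))]
  simp only [Equiv.Perm.sign_one, Units.val_one, Int.cast_one, one_mul, Equiv.Perm.one_apply]
  rw [add_sub_assoc]
  refine (norm_add_le_max' _ _).trans (max_le ?_ ?_)
  · refine IsUltrametricDist.norm_sum_le_of_forall_le_of_nonneg hr0 fun σ hσ => ?_
    have hσ1 : σ ≠ 1 := Finset.ne_of_mem_erase hσ
    obtain ⟨i₀, hi₀⟩ : ∃ i, σ i ≠ i := not_forall.mp fun h => hσ1 (Equiv.ext h)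
    have h1 : ‖(((Equiv.Perm.sign σ : ℤˣ) : ℤ) : CompletedAlgClosure F)‖ = 1 := by
      rcases Int.units_eq_one_or (Equiv.Perm.sign σ) with h | h <;> simp [h]
    rw [norm_mul, h1, one_mul, ← Finset.prod_erase_mul _ _ (Finset.mem_univ i₀), norm_mul]
    calc ‖∏ i ∈ Finset.univ.erase i₀, (1 + C : Matrix m m (CompletedAlgClosure F)) (σ i) i‖ *
          ‖(1 + C : Matrix m m (CompletedAlgClosure F)) (σ i₀) i₀‖ ≤ 1 * r := by
          refine mul_le_mul ?_ ((hent _ _).2 hi₀) (norm_nonneg _) zero_le_one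
          rw [norm_prod]
          exact Finset.prod_le_one (fun i _ => norm_nonneg _) fun i _ => (hent _ _).1
      _ = r := one_mul r
  · simp only [Matrix.add_apply, Matrix.one_apply_eq]
    exact norm_prod_one_add_sub_one_le hr0 hr1.le fun i => hC i i

omit [CharZero F] in
/-- `1 + C` is invertible for `‖C‖ < 1`, with `‖det(1 + C)‖ = 1`. [folklore] -/
private theorem norm_det_one_add_eq_one {C : Matrix m m (CompletedAlgClosure F)} {r : ℝ}
    (hr0 : 0 ≤ r) (hr1 : r < 1) (hC : ∀ i j, ‖C i j‖ ≤ r) :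
    ‖(1 + C : Matrix m m (CompletedAlgClosure F)).det‖ = 1 := by
  have h := norm_det_one_add_sub_one_le hr0 hr1 hC
  have h1 : (1 + C : Matrix m m (CompletedAlgClosure F)).det =
      1 + ((1 + C : Matrix m m (CompletedAlgClosure F)).det - 1) := by ring
  rw [h1]
  exact norm_one_add_eq (h.trans_lt hr1)

omit [CharZero F] in
/-- `B` with `‖B − 1‖ ≤ r < 1` entrywise has `‖det B‖ = 1`, so is invertible. [folklore] -/
private theorem isUnit_det_of_norm_sub_one_le {B : Matrix m m (CompletedAlgClosure F)} {r : ℝ}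
    (hr0 : 0 ≤ r) (hr1 : r < 1) (hB : ∀ i j, ‖(B - 1) i j‖ ≤ r) : IsUnit B.det := by
  have h := norm_det_one_add_eq_one hr0 hr1 hB
  rw [add_sub_cancel] at h
  refine isUnit_iff_ne_zero.mpr fun h0 => ?_
  rw [h0, norm_zero] at h
  exact zero_ne_one h

omit [CharZero F] in
/-- `‖(1 + C)⁻¹‖ ≤ 1` for `‖C‖ < 1` (adjugate formula). [folklore] -/
private theorem norm_inv_one_add_apply_le {C : Matrix m m (CompletedAlgClosure F)} {r : ℝ}
    (hr0 : 0 ≤ r) (hr1 : r < 1) (hC : ∀ i j, ‖C i j‖ ≤ r) (i j : m) :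
    ‖(1 + C : Matrix m m (CompletedAlgClosure F))⁻¹ i j‖ ≤ 1 := by
  have hdet := norm_det_one_add_eq_one hr0 hr1 hC
  have hent := norm_one_add_apply_le hr1.le hC
  rw [Matrix.inv_def, Matrix.smul_apply, smul_eq_mul, Ring.inverse_eq_inv, norm_mul, norm_inv, hdet,
    inv_one, one_mul, Matrix.adjugate_apply]
  refine norm_det_le_one fun i' j' => ?_
  rw [Matrix.updateRow_apply]
  split_ifs with h
  · by_cases hij : j' = i
    · subst hij; rw [Pi.single_eq_same, norm_one]
    · rw [Pi.single_eq_of_ne hij, norm_zero]; exact zero_le_one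
  · exact (hent _ _).1

/-- `‖g y − y‖ ≤ ‖y‖` (`g ∈ G₀` is an isometry of `ℂ_F`). [folklore] -/
private theorem norm_smul_sub_le' (g : BaseGaloisGroup hp) (y : CompletedAlgClosure F) :
    ‖g • y - y‖ ≤ ‖y‖ := by
  refine (norm_sub_le_max' _ _).trans (max_le (le_of_eq ?_) le_rfl)
  exact CompletedAlgClosure.norm_base_smul hp g y

omit [Fintype m] in
/-- `g` fixes the entries of the identity matrix. [folklore] -/
private theorem smul_one_apply' (g : BaseGaloisGroup hp) (i j : m) :
    g • (1 : Matrix m m (CompletedAlgClosure F)) i j = (1 : Matrix m m (CompletedAlgClosure F)) i j := by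
  rw [Matrix.one_apply]
  split_ifs
  · exact smul_one g
  · exact smul_zero g

omit [CharZero F] in
/-- `(B(1+C))⁻¹ · U · f(B(1+C)) = (1+C)⁻¹ · (B⁻¹ U f(B)) · (1 + f(C))` for a ring endomorphism `f`
applied entrywise. [folklore] -/
private theorem conj_mul_one_add' (f : CompletedAlgClosure F →+* CompletedAlgClosure F)
    (U B C : Matrix m m (CompletedAlgClosure F)) :
    (B * (1 + C))⁻¹ * U * (B * (1 + C)).map f = (1 + C)⁻¹ * (B⁻¹ * U * B.map f) * (1 + C.map f) := by
  rw [Matrix.mul_inv_rev, Matrix.map_mul, Matrix.map_add f (map_add f),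
    Matrix.map_one f (map_zero f) (map_one f)]
  simp only [Matrix.mul_assoc]

/-! ### Matrices with entries in a subfield `A ⊆ ℂ_F` -/

omit [CharZero F] [DecidableEq m] in
/-- Products of matrices over `A` are over `A`. [folklore] -/
private theorem mul_apply_memA (A : Subfield (CompletedAlgClosure F)) {M N : Matrix m m (CompletedAlgClosure F)}
    (hM : ∀ i j, M i j ∈ A) (hN : ∀ i j, N i j ∈ A) (i j : m) : (M * N) i j ∈ A := by
  rw [Matrix.mul_apply]
  exact sum_mem fun k _ => mul_mem (hM i k) (hN k j)

omit [CharZero F] [Fintype m] [DecidableEq m] in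
/-- Sums of matrices over `A` are over `A`. [folklore] -/
private theorem add_apply_memA (A : Subfield (CompletedAlgClosure F)) {M N : Matrix m m (CompletedAlgClosure F)}
    (hM : ∀ i j, M i j ∈ A) (hN : ∀ i j, N i j ∈ A) (i j : m) : (M + N) i j ∈ A := by
  rw [Matrix.add_apply]; exact add_mem (hM i j) (hN i j)

omit [CharZero F] [Fintype m] [DecidableEq m] in
/-- Differences of matrices over `A` are over `A`. [folklore] -/
private theorem sub_apply_memA (A : Subfield (CompletedAlgClosure F)) {M N : Matrix m m (CompletedAlgClosure F)}
    (hM : ∀ i j, M i j ∈ A) (hN : ∀ i j, N i j ∈ A) (i j : m) : (M - N) i j ∈ A := by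
  rw [Matrix.sub_apply]; exact sub_mem (hM i j) (hN i j)

omit [CharZero F] [Fintype m] in
/-- `1 ∈ M_d(A)`. [folklore] -/
private theorem one_apply_memA (A : Subfield (CompletedAlgClosure F)) (i j : m) :
    (1 : Matrix m m (CompletedAlgClosure F)) i j ∈ A := by
  rw [Matrix.one_apply]
  split_ifs
  · exact one_mem A
  · exact zero_mem A

omit [Fintype m] [DecidableEq m] in
/-- `g(M) ∈ M_d(A)` when `g A ⊆ A`. [folklore] -/
private theorem map_smul_apply_memA (A : Subfield (CompletedAlgClosure F)) {g : BaseGaloisGroup hp}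
    (hg : ∀ x ∈ A, g • x ∈ A) {M : Matrix m m (CompletedAlgClosure F)} (hM : ∀ i j, M i j ∈ A) (i j : m) :
    (M.map fun x => g • x) i j ∈ A := by
  rw [Matrix.map_apply]; exact hg _ (hM i j)

omit [CharZero F] in
/-- The inverse of a matrix over the subfield `A` is over `A`. [folklore] -/
private theorem inv_apply_memA (A : Subfield (CompletedAlgClosure F)) {M : Matrix m m (CompletedAlgClosure F)}
    (hM : ∀ i j, M i j ∈ A) (i j : m) : M⁻¹ i j ∈ A := by
  set M' : Matrix m m A := fun i j => ⟨M i j, hM i j⟩ with hM'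
  have hMM' : A.subtype.mapMatrix M' = M := by
    ext i j; rfl
  have hdet : M.det ∈ A := by
    rw [← hMM', ← RingHom.map_det]
    exact (M'.det).2
  have hadj : M.adjugate i j ∈ A := by
    rw [← hMM', ← RingHom.map_adjugate]
    exact (M'.adjugate i j).2
  rw [Matrix.inv_def, Matrix.smul_apply, smul_eq_mul, Ring.inverse_eq_inv]
  exact mul_mem (inv_mem hdet) hadj

/-! ### Additivity and fixed-linearity of `R` on `A` -/

omit [CharZero F] [Fintype m] [DecidableEq m] in
/-- `R 0 = 0`. [folklore] -/
private theorem mapR_zero {A : Subfield (CompletedAlgClosure F)} {R : CompletedAlgClosure F → CompletedAlgClosure F}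
    (hRsub : ∀ x ∈ A, ∀ y ∈ A, R (x - y) = R x - R y) : R 0 = 0 := by
  have h := hRsub 0 (zero_mem A) 0 (zero_mem A)
  rwa [sub_zero, eq_comm, sub_eq_self] at h

omit [CharZero F] [Fintype m] [DecidableEq m] in
/-- `R (x + y) = R x + R y` on `A`. [folklore] -/
private theorem mapR_add {A : Subfield (CompletedAlgClosure F)} {R : CompletedAlgClosure F → CompletedAlgClosure F}
    (hRsub : ∀ x ∈ A, ∀ y ∈ A, R (x - y) = R x - R y) {x y : CompletedAlgClosure F} (hx : x ∈ A)
    (hy : y ∈ A) : R (x + y) = R x + R y := by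
  have h1 : R (x + y - y) = R (x + y) - R y := hRsub _ (add_mem hx hy) _ hy
  rw [add_sub_cancel_right] at h1
  rw [h1, sub_add_cancel]

omit [CharZero F] [Fintype m] [DecidableEq m] in
/-- `R (∑ f) = ∑ R ∘ f` on `A`. [folklore] -/
private theorem mapR_sum {A : Subfield (CompletedAlgClosure F)} {R : CompletedAlgClosure F → CompletedAlgClosure F}
    (hRsub : ∀ x ∈ A, ∀ y ∈ A, R (x - y) = R x - R y) {ι : Type} (s : Finset ι)
    (f : ι → CompletedAlgClosure F) (hf : ∀ i ∈ s, f i ∈ A) : R (∑ i ∈ s, f i) = ∑ i ∈ s, R (f i) := by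
  classical
  induction s using Finset.induction_on with
  | empty => rw [Finset.sum_empty, Finset.sum_empty]; exact mapR_zero hRsub
  | @insert a s ha ih =>
    have hf' : ∀ i ∈ s, f i ∈ A := fun i hi => hf i (Finset.mem_insert_of_mem hi)
    rw [Finset.sum_insert ha, Finset.sum_insert ha,
      mapR_add hRsub (hf a (Finset.mem_insert_self a s)) (sum_mem fun i hi => hf' i hi), ih hf']

omit [Fintype m] [DecidableEq m] in
/-- (TS3) forces `R a = a` for `γ`-fixed `a ∈ A`. [folklore] -/
private theorem mapR_eq_self_of_smul_eq {A : Subfield (CompletedAlgClosure F)} {γ : BaseGaloisGroup hp}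
    {R : CompletedAlgClosure F → CompletedAlgClosure F} {c₃ : ℝ}
    (hR₃ : ∀ x ∈ A, ‖x - R x‖ ≤ c₃ * ‖γ • x - x‖) {a : CompletedAlgClosure F} (ha : a ∈ A)
    (hγa : γ • a = a) : R a = a := by
  have h := hR₃ a ha
  rw [hγa, sub_self, norm_zero, mul_zero] at h
  exact (sub_eq_zero.mp (norm_le_zero_iff.mp h)).symm

omit [DecidableEq m] in
/-- **`R` entrywise commutes with two-sided multiplication by `γ`-fixed matrices over `A`**:
`R((V₁ B V₂)_{ij}) = (V₁ R(B) V₂)_{ij}` (fixed-linearity, summed).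
[cite: BergerColmez2008, Déf. 3.1.3 (TS2)(2) and Lemme 3.2.5] -/
theorem map_mul_mul_apply_subfield {A : Subfield (CompletedAlgClosure F)} {γ : BaseGaloisGroup hp}
    {R : CompletedAlgClosure F → CompletedAlgClosure F}
    (hRsub : ∀ x ∈ A, ∀ y ∈ A, R (x - y) = R x - R y)
    (hRmul : ∀ a ∈ A, ∀ x ∈ A, γ • a = a → R (a * x) = a * R x)
    {B V₁ V₂ : Matrix m m (CompletedAlgClosure F)}
    (hB : ∀ i j, B i j ∈ A) (hV₁ : ∀ i j, V₁ i j ∈ A) (hV₂ : ∀ i j, V₂ i j ∈ A)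
    (hγV₁ : ∀ i j, γ • V₁ i j = V₁ i j) (hγV₂ : ∀ i j, γ • V₂ i j = V₂ i j) (i j : m) :
    R ((V₁ * B * V₂) i j) = (V₁ * B.map R * V₂) i j := by
  have hexp : (V₁ * B * V₂) i j = ∑ l, ∑ k, V₁ i k * B k l * V₂ l j := by
    rw [Matrix.mul_apply]
    refine Finset.sum_congr rfl fun l _ => ?_
    rw [Matrix.mul_apply, Finset.sum_mul]
  have hexp' : (V₁ * B.map R * V₂) i j = ∑ l, ∑ k, V₁ i k * R (B k l) * V₂ l j := by
    rw [Matrix.mul_apply]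
    refine Finset.sum_congr rfl fun l _ => ?_
    rw [Matrix.mul_apply, Finset.sum_mul]
    rfl
  have hterm : ∀ l k, V₁ i k * B k l * V₂ l j ∈ A := fun l k =>
    mul_mem (mul_mem (hV₁ i k) (hB k l)) (hV₂ l j)
  rw [hexp, hexp', mapR_sum hRsub _ _ fun l _ => sum_mem fun k _ => hterm l k]
  refine Finset.sum_congr rfl fun l _ => ?_
  rw [mapR_sum hRsub _ _ fun k _ => hterm l k]
  refine Finset.sum_congr rfl fun k _ => ?_
  -- `R(v₁ b v₂) = v₁ R(b v₂) = v₁ R(v₂ b) = v₁ v₂ R(b)`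
  rw [show V₁ i k * B k l * V₂ l j = V₁ i k * (B k l * V₂ l j) from mul_assoc _ _ _,
    hRmul _ (hV₁ i k) _ (mul_mem (hB k l) (hV₂ l j)) (hγV₁ i k), mul_comm (B k l) (V₂ l j),
    hRmul _ (hV₂ l j) _ (hB k l) (hγV₂ l j)]
  ring

/-! ### Berger–Colmez, Lemme 3.2.5 over the datum -/

/-- ★ **Berger–Colmez, Lemme 3.2.5 over a Tate–Sen datum.** Let `R` be, on the subfield `A`, an additive
idempotent with `γ`-fixed values in `A`, linear over the `γ`-invariants of `A`, with `R ∘ γ = R` and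
(TS3) `‖x − R x‖ ≤ c₃‖γx − x‖`. Let `B ∈ M_d(A)` and let `V₁, V₂ ∈ M_d(A)` be fixed by `γ` entrywise
with `‖V₁ − 1‖, ‖V₂ − 1‖ ≤ r`, `r < 1`, `c₃ r < 1`. If `γ(B) = V₁ · B · V₂` then `γ` fixes `B` entrywise.
Proof: `C = B − R(B)` satisfies `γC − C = (V₁ − 1) C V₂ + C (V₂ − 1)`, so `‖γC − C‖ ≤ r‖C‖`, while
(TS3) and `R(C) = 0` give `‖C‖ ≤ c₃‖γC − C‖`. [cite: BergerColmez2008, Lemme 3.2.5]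
[cite: Tate1967, §3.2 Prop. 7] -/
theorem matrix_smul_eq_of_map_eq_mul_mul_subfield {A : Subfield (CompletedAlgClosure F)}
    {γ : BaseGaloisGroup hp} {R : CompletedAlgClosure F → CompletedAlgClosure F} {c₃ : ℝ}
    (hRA : ∀ x ∈ A, R x ∈ A) (hγR : ∀ x ∈ A, γ • R x = R x) (hRR : ∀ x ∈ A, R (R x) = R x)
    (hRsub : ∀ x ∈ A, ∀ y ∈ A, R (x - y) = R x - R y)
    (hRmul : ∀ a ∈ A, ∀ x ∈ A, γ • a = a → R (a * x) = a * R x)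
    (hRγ : ∀ x ∈ A, R (γ • x) = R x) (hc₃ : 0 ≤ c₃)
    (hR₃ : ∀ x ∈ A, ‖x - R x‖ ≤ c₃ * ‖γ • x - x‖)
    {B V₁ V₂ : Matrix m m (CompletedAlgClosure F)} (hB : ∀ i j, B i j ∈ A)
    (hV₁ : ∀ i j, V₁ i j ∈ A) (hV₂ : ∀ i j, V₂ i j ∈ A)
    (hγV₁ : ∀ i j, γ • V₁ i j = V₁ i j) (hγV₂ : ∀ i j, γ • V₂ i j = V₂ i j)
    {r : ℝ} (hr1 : r < 1) (hr : c₃ * r < 1) (hV₁r : ∀ i j, ‖(V₁ - 1) i j‖ ≤ r)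
    (hV₂r : ∀ i j, ‖(V₂ - 1) i j‖ ≤ r)
    (hγB : (B.map fun x => γ • x) = V₁ * B * V₂) :
    ∀ i j, γ • B i j = B i j := by
  rcases isEmpty_or_nonempty m with hm | ⟨⟨i₁⟩⟩
  · exact fun i => isEmptyElim i
  have hr0 : 0 ≤ r := (norm_nonneg _).trans (hV₁r i₁ i₁)
  -- `RB = R(B)` entrywise, `C = B − RB`
  set RB : Matrix m m (CompletedAlgClosure F) := B.map R with hRB_def
  have hRB_apply : ∀ k l, RB k l = R (B k l) := fun k l => rfl
  have hRBA : ∀ k l, RB k l ∈ A := fun k l => by rw [hRB_apply]; exact hRA _ (hB k l)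
  have hγRB : ∀ k l, γ • RB k l = RB k l := fun k l => by rw [hRB_apply]; exact hγR _ (hB k l)
  have hγBij : ∀ i j, γ • B i j = (V₁ * B * V₂) i j := fun i j => by
    have h := congrFun (congrFun hγB i) j
    rwa [Matrix.map_apply] at h
  -- `R(B) = V₁ R(B) V₂`
  have hkey : ∀ i j, RB i j = (V₁ * RB * V₂) i j := by
    intro i j
    rw [hRB_apply, ← hRγ _ (hB i j), hγBij, hRB_def]
    exact map_mul_mul_apply_subfield hp hRsub hRmul hB hV₁ hV₂ hγV₁ hγV₂ i j
  -- hence `γ C − C = (V₁ − 1) C V₂ + C (V₂ − 1)`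
  have hCA : ∀ i j, (B - RB) i j ∈ A := fun i j => by
    rw [Matrix.sub_apply]; exact sub_mem (hB i j) (hRBA i j)
  have hγC : ∀ i j, γ • (B - RB) i j - (B - RB) i j =
      ((V₁ - 1) * (B - RB) * V₂ + (B - RB) * (V₂ - 1)) i j := by
    intro i j
    have hmat : (V₁ - 1) * (B - RB) * V₂ + (B - RB) * (V₂ - 1) = V₁ * B * V₂ - V₁ * RB * V₂ - (B - RB) := by
      noncomm_ring
    rw [hmat, Matrix.sub_apply, Matrix.sub_apply, Matrix.sub_apply, smul_sub, hγBij, hγRB, ← hkey,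
      Matrix.sub_apply]
  -- norms: `‖V₂‖ ≤ 1`
  have hV₂n : ∀ i j, ‖V₂ i j‖ ≤ 1 := by
    intro i j
    have h := (norm_one_add_apply_le hr1.le hV₂r i j).1
    rwa [add_sub_cancel] at h
  -- the largest entry of `C`
  haveI : Nonempty (m × m) := ⟨(i₁, i₁)⟩
  obtain ⟨⟨i₀, j₀⟩, -, hmax⟩ := Finset.exists_max_image (Finset.univ : Finset (m × m))
    (fun q => ‖(B - RB) q.1 q.2‖) Finset.univ_nonempty
  set c : ℝ := ‖(B - RB) i₀ j₀‖ with hc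
  have hc0 : 0 ≤ c := norm_nonneg _
  have hCc : ∀ i j, ‖(B - RB) i j‖ ≤ c := fun i j => hmax ⟨i, j⟩ (Finset.mem_univ _)
  -- `‖γ C − C‖ ≤ r c`
  have hbound : ∀ i j, ‖γ • (B - RB) i j - (B - RB) i j‖ ≤ r * c := by
    intro i j
    rw [hγC]
    have h1 : ∀ i j, ‖((V₁ - 1) * (B - RB) * V₂) i j‖ ≤ r * c * 1 :=
      norm_mul_apply_le (mul_nonneg hr0 hc0) zero_le_one (norm_mul_apply_le hr0 hc0 hV₁r hCc) hV₂n
    have h2 : ∀ i j, ‖((B - RB) * (V₂ - 1)) i j‖ ≤ c * r := norm_mul_apply_le hc0 hr0 hCc hV₂r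
    refine (norm_add_apply_le h1 h2 i j).trans (max_le (le_of_eq (mul_one _)) (le_of_eq (mul_comm _ _)))
  -- (TS3): `R(C_{ij}) = 0`, so `‖C_{ij}‖ ≤ c₃ ‖γ C_{ij} − C_{ij}‖ ≤ c₃ r c`
  have hRC : ∀ i j, R ((B - RB) i j) = 0 := fun i j => by
    rw [Matrix.sub_apply, hRsub _ (hB i j) _ (hRBA i j), hRB_apply, hRR _ (hB i j), sub_self]
  have hTS3 : ∀ i j, ‖(B - RB) i j‖ ≤ c₃ * (r * c) := by
    intro i j
    have h := hR₃ _ (hCA i j)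
    rw [hRC, sub_zero] at h
    exact h.trans (mul_le_mul_of_nonneg_left (hbound i j) hc₃)
  -- `c ≤ (c₃ r) c` with `c₃ r < 1` forces `c = 0`
  have hc_eq : c = 0 := by
    by_contra hne
    have hcpos : 0 < c := lt_of_le_of_ne hc0 (Ne.symm hne)
    have h := hTS3 i₀ j₀
    rw [← hc, ← mul_assoc] at h
    exact absurd h (not_le.mpr (mul_lt_of_lt_one_left hcpos hr))
  -- conclusion: `B = R(B)` entrywise, which is `γ`-fixed
  intro i j
  have h0 : (B - RB) i j = 0 := by
    have h := hCc i j; rw [hc_eq] at h; exact norm_le_zero_iff.mp h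
  rw [Matrix.sub_apply, sub_eq_zero] at h0
  rw [h0]; exact hγRB i j

/-! ### Propagation along an element commuting with `γ` on `A` -/

omit [Fintype m] [DecidableEq m] in
/-- `g(h(M)) = h(g(M))` entrywise for `M ∈ M_d(A)` when `g h = h g` on `A`. [folklore] -/
private theorem map_map_comm_of_memA (A : Subfield (CompletedAlgClosure F)) {g h : BaseGaloisGroup hp}
    (hgh : ∀ x ∈ A, g • h • x = h • g • x) {M : Matrix m m (CompletedAlgClosure F)}
    (hM : ∀ i j, M i j ∈ A) :
    ((M.map fun x => h • x).map fun x => g • x) = (M.map fun x => g • x).map fun x => h • x := by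
  ext i j
  simp only [Matrix.map_apply]
  exact hgh _ (hM i j)

/-- If `γ` fixes the invertible `W` entrywise then it fixes `W⁻¹` entrywise. [folklore] -/
private theorem map_inv_eq_of_map_eq_gen {γ : BaseGaloisGroup hp} {W : Matrix m m (CompletedAlgClosure F)}
    (hdet : IsUnit W.det) (hγW : ∀ i j, γ • W i j = W i j) (i j : m) :
    γ • W⁻¹ i j = W⁻¹ i j := by
  set f : CompletedAlgClosure F →+* CompletedAlgClosure F :=
    MulSemiringAction.toRingHom (BaseGaloisGroup hp) (CompletedAlgClosure F) γ with hf_def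
  have hWf : W.map f = W := by
    ext k l; rw [Matrix.map_apply]; exact hγW k l
  have h1 : (W⁻¹).map f * W = 1 := by
    calc (W⁻¹).map f * W = (W⁻¹).map f * W.map f := by rw [hWf]
      _ = (W⁻¹ * W).map f := by rw [← Matrix.map_mul]
      _ = 1 := by rw [Matrix.nonsing_inv_mul W hdet, Matrix.map_one f (map_zero f) (map_one f)]
  have h2 : W⁻¹ = (W⁻¹).map f := Matrix.inv_eq_left_inv h1
  have h3 := congrFun (congrFun h2 i) j
  rw [Matrix.map_apply] at h3
  exact h3.symm

/-- ★ **Propagation of decompletion over a Tate–Sen datum (Berger–Colmez, Prop. 3.2.6, last step).**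
With `R` as in `matrix_smul_eq_of_map_eq_mul_mul_subfield`, let `τ ∈ G₀` preserve `A` and commute
with `γ` on `A`. Let `W ∈ M_d(A)` be fixed by `γ` entrywise with `‖W − 1‖ ≤ r`, `r < 1`, `c₃ r < 1`,
and let `V ∈ M_d(A)` satisfy `γ(V) = W⁻¹ · V · τ(W)`. Then `γ` fixes `V` entrywise.
[cite: BergerColmez2008, Lemme 3.2.5 and Prop. 3.2.6] -/
theorem matrix_smul_eq_of_map_eq_inv_mul_map_subfield {A : Subfield (CompletedAlgClosure F)}
    {γ τ : BaseGaloisGroup hp} {R : CompletedAlgClosure F → CompletedAlgClosure F} {c₃ : ℝ}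
    (hRA : ∀ x ∈ A, R x ∈ A) (hγR : ∀ x ∈ A, γ • R x = R x) (hRR : ∀ x ∈ A, R (R x) = R x)
    (hRsub : ∀ x ∈ A, ∀ y ∈ A, R (x - y) = R x - R y)
    (hRmul : ∀ a ∈ A, ∀ x ∈ A, γ • a = a → R (a * x) = a * R x)
    (hRγ : ∀ x ∈ A, R (γ • x) = R x) (hc₃ : 0 ≤ c₃)
    (hR₃ : ∀ x ∈ A, ‖x - R x‖ ≤ c₃ * ‖γ • x - x‖)
    (hτA : ∀ x ∈ A, τ • x ∈ A) (hγτ : ∀ x ∈ A, γ • τ • x = τ • γ • x)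
    {W V : Matrix m m (CompletedAlgClosure F)} (hW : ∀ i j, W i j ∈ A)
    (hγW : ∀ i j, γ • W i j = W i j) {r : ℝ} (hr1 : r < 1) (hr : c₃ * r < 1)
    (hWr : ∀ i j, ‖(W - 1) i j‖ ≤ r) (hV : ∀ i j, V i j ∈ A)
    (hγV : (V.map fun x => γ • x) = W⁻¹ * V * W.map fun x => τ • x) :
    ∀ i j, γ • V i j = V i j := by
  rcases isEmpty_or_nonempty m with hm | ⟨⟨i₁⟩⟩
  · exact fun i => isEmptyElim i
  have hr0 : 0 ≤ r := (norm_nonneg _).trans (hWr i₁ i₁)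
  obtain ⟨hdet, hWinv⟩ := isUnit_det_and_norm_inv_sub_one_le hr0 hr1 hWr
  refine matrix_smul_eq_of_map_eq_mul_mul_subfield hp hRA hγR hRR hRsub hRmul hRγ hc₃ hR₃ hV
    (fun i j => inv_apply_memA A hW i j) (fun i j => map_smul_apply_memA hp A hτA hW i j)
    (map_inv_eq_of_map_eq_gen hp hdet hγW) (fun i j => ?_) hr1 hr hWinv (fun i j => ?_) hγV
  · rw [Matrix.map_apply, hγτ _ (hW i j), hγW]
  · rw [Matrix.sub_apply, Matrix.map_apply, ← smul_one_apply' hp τ i j, ← smul_sub,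
      CompletedAlgClosure.norm_base_smul hp, ← Matrix.sub_apply]
    exact hWr i j

/-! ### The a-priori bound over the datum -/

/-- **The a-priori bound (Berger–Colmez, proof of Prop. 3.2.6; Sen 1980, Lemma 1) over a Tate–Sen
datum.** Let `R` be, on `A`, an additive idempotent with `γ`-fixed values in `A`, linear over the
`γ`-invariants, with `R ∘ γ = R`, (TS2) `‖R x‖ ≤ c₂‖x‖` and (TS3). Let `B, U, W ∈ M_d(A)` with `W` fixed by
`γ` entrywise and `B · W = U · γ(B)`, `‖B − 1‖ ≤ d ≤ 1`, `c₂ d < 1`, `‖U − 1‖ ≤ u`. Then `‖W − 1‖ ≤ c₂ u`.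
Proof: with `D = B − 1`, `E = U − 1`, `T = W − 1`: `T = e + (γ(D) − D W)`, `e = E + Eγ(D)`; applying `R`
entrywise (`R T = T`, `R γ(D) = R D`, `R(D W) = R(D) W`) gives `T = R(e) − R(D) T`, whence
`‖T‖ ≤ max (c₂ u) (c₂ d ‖T‖)`. [cite: BergerColmez2008, Prop. 3.2.6] [cite: Sen1980, Lemma 1] -/
theorem norm_fixed_conj_sub_one_le_subfield {A : Subfield (CompletedAlgClosure F)}
    {γ : BaseGaloisGroup hp} {R : CompletedAlgClosure F → CompletedAlgClosure F} {c₂ c₃ : ℝ}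
    (hγA : ∀ x ∈ A, γ • x ∈ A)
    (hRsub : ∀ x ∈ A, ∀ y ∈ A, R (x - y) = R x - R y)
    (hRmul : ∀ a ∈ A, ∀ x ∈ A, γ • a = a → R (a * x) = a * R x)
    (hRγ : ∀ x ∈ A, R (γ • x) = R x) (hc₂ : 0 ≤ c₂) (hR₂ : ∀ x ∈ A, ‖R x‖ ≤ c₂ * ‖x‖)
    (hR₃ : ∀ x ∈ A, ‖x - R x‖ ≤ c₃ * ‖γ • x - x‖)
    {B U W : Matrix m m (CompletedAlgClosure F)} (hB : ∀ i j, B i j ∈ A) (hU : ∀ i j, U i j ∈ A)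
    (hW : ∀ i j, W i j ∈ A) (hγW : ∀ i j, γ • W i j = W i j)
    (hBW : B * W = U * B.map fun x => γ • x) {d u : ℝ} (hd0 : 0 ≤ d) (hd1 : d ≤ 1)
    (hd : c₂ * d < 1) (hu0 : 0 ≤ u) (hBd : ∀ i j, ‖(B - 1) i j‖ ≤ d)
    (hUu : ∀ i j, ‖(U - 1) i j‖ ≤ u) :
    ∀ i j, ‖(W - 1) i j‖ ≤ c₂ * u := by
  rcases isEmpty_or_nonempty m with hm | ⟨⟨i₁⟩⟩
  · exact fun i => isEmptyElim i
  set f : CompletedAlgClosure F →+* CompletedAlgClosure F :=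
    MulSemiringAction.toRingHom (BaseGaloisGroup hp) (CompletedAlgClosure F) γ with hf_def
  have hf : (fun x : CompletedAlgClosure F => γ • x) = ⇑f := by
    funext x; simp [hf_def]
  rw [hf] at hBW
  -- the pieces `D = B − 1`, `E = U − 1`, `T = W − 1`, `γ(D) = γ(B) − 1`
  have hDA : ∀ i j, (B - 1) i j ∈ A := sub_apply_memA A hB (one_apply_memA A)
  have hEA : ∀ i j, (U - 1) i j ∈ A := sub_apply_memA A hU (one_apply_memA A)
  have hTA : ∀ i j, (W - 1) i j ∈ A := sub_apply_memA A hW (one_apply_memA A)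
  have hγT : ∀ i j, γ • (W - 1) i j = (W - 1) i j := fun i j => by
    rw [Matrix.sub_apply, smul_sub, hγW, smul_one_apply' hp]
  have hDγ : B.map f - 1 = (B - 1).map f := by
    rw [Matrix.map_sub f (map_sub f), Matrix.map_one f (map_zero f) (map_one f)]
  have hDγA : ∀ i j, (B.map f - 1) i j ∈ A := fun i j => by
    rw [hDγ, Matrix.map_apply]; exact hγA _ (hDA i j)
  have hDγd : ∀ i j, ‖(B.map f - 1) i j‖ ≤ d := fun i j => by
    rw [hDγ, Matrix.map_apply]
    show ‖γ • (B - 1) i j‖ ≤ d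
    rw [CompletedAlgClosure.norm_base_smul hp]; exact hBd i j
  -- `e = E + E γ(D)`, `‖e‖ ≤ u`
  have heA : ∀ i j, (U - 1 + (U - 1) * (B.map f - 1)) i j ∈ A :=
    add_apply_memA A hEA (mul_apply_memA A hEA hDγA)
  have heu : ∀ i j, ‖(U - 1 + (U - 1) * (B.map f - 1)) i j‖ ≤ u := fun i j =>
    (norm_add_apply_le hUu (norm_mul_apply_le hu0 hd0 hUu hDγd) i j).trans
      (max_le le_rfl (by nlinarith))
  -- the identity `T = e + (γ(D) − D W)`
  have hid : W - 1 = (U - 1 + (U - 1) * (B.map f - 1)) + ((B.map f - 1) - (B - 1) * W) := by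
    have h : (U - 1 + (U - 1) * (B.map f - 1)) + ((B.map f - 1) - (B - 1) * W) =
        U * B.map f - 1 - B * W + W := by noncomm_ring
    rw [h, hBW]; abel
  -- `RD = R(D)` entrywise; `‖RD‖ ≤ c₂ d`
  set RD : Matrix m m (CompletedAlgClosure F) := (B - 1).map R with hRD_def
  have hRD_apply : ∀ k l, RD k l = R ((B - 1) k l) := fun k l => rfl
  have hRDn : ∀ k l, ‖RD k l‖ ≤ c₂ * d := fun k l => by
    rw [hRD_apply]
    exact (hR₂ _ (hDA k l)).trans (mul_le_mul_of_nonneg_left (hBd k l) hc₂)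
  -- apply `R` entrywise: `T_{ij} = R(e_{ij}) + (RD_{ij} − (RD W)_{ij})`
  have hRT : ∀ i j, (W - 1) i j = R ((U - 1 + (U - 1) * (B.map f - 1)) i j) + (RD i j - (RD * W) i j) := by
    intro i j
    have h0 : R ((W - 1) i j) = (W - 1) i j := mapR_eq_self_of_smul_eq hp hR₃ (hTA i j) (hγT i j)
    have hgA : ∀ i j, ((B.map f - 1) - (B - 1) * W) i j ∈ A :=
      sub_apply_memA A hDγA (mul_apply_memA A hDA hW)
    have h1 : (W - 1) i j = (U - 1 + (U - 1) * (B.map f - 1)) i j + ((B.map f - 1) - (B - 1) * W) i j := by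
      rw [← Matrix.add_apply, ← hid]
    -- `R((γD − DW)_{ij}) = R(γ D_{ij}) − R((D W)_{ij}) = RD_{ij} − (RD W)_{ij}`
    have hDWA : ∀ i j, ((B - 1) * W) i j ∈ A := mul_apply_memA A hDA hW
    have h3 : R ((B.map f - 1) i j) = RD i j := by
      rw [hDγ, Matrix.map_apply, hRD_apply]
      show R (γ • (B - 1) i j) = R ((B - 1) i j)
      exact hRγ _ (hDA i j)
    have h5 : R (((B - 1) * W) i j) = (RD * W) i j := by
      have h6 : (B - 1) * W = 1 * (B - 1) * W := by rw [Matrix.one_mul]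
      have h7 : RD * W = 1 * RD * W := by rw [Matrix.one_mul]
      rw [h6, h7, hRD_def]
      exact map_mul_mul_apply_subfield hp hRsub hRmul hDA (one_apply_memA A) hW
        (smul_one_apply' hp γ) hγW i j
    rw [← h0, h1, mapR_add hRsub (heA i j) (hgA i j), Matrix.sub_apply (B.map f - 1),
      hRsub _ (hDγA i j) _ (hDWA i j), h3, h5]
  -- the largest entry of `T`
  haveI : Nonempty (m × m) := ⟨(i₁, i₁)⟩
  obtain ⟨⟨i₀, j₀⟩, -, hmax⟩ := Finset.exists_max_image (Finset.univ : Finset (m × m))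
    (fun q => ‖(W - 1) q.1 q.2‖) Finset.univ_nonempty
  set c : ℝ := ‖(W - 1) i₀ j₀‖ with hc
  have hc0 : 0 ≤ c := norm_nonneg _
  have hTc : ∀ i j, ‖(W - 1) i j‖ ≤ c := fun i j => hmax ⟨i, j⟩ (Finset.mem_univ _)
  -- `‖T_{ij}‖ ≤ max (c₂ u) (c₂ d c)`
  have hbound : ∀ i j, ‖(W - 1) i j‖ ≤ max (c₂ * u) (c₂ * d * c) := by
    intro i j
    rw [hRT i j]
    refine (norm_add_le_max' _ _).trans (max_le_max ?_ ?_)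
    · exact (hR₂ _ (heA i j)).trans (mul_le_mul_of_nonneg_left (heu i j) hc₂)
    · have h : RD i j - (RD * W) i j = -((RD * (W - 1)) i j) := by
        rw [Matrix.mul_sub, Matrix.mul_one, Matrix.sub_apply]; ring
      rw [h, norm_neg]
      exact norm_mul_apply_le (mul_nonneg hc₂ hd0) hc0 hRDn hTc i j
  -- `c₂ d < 1` forces `c ≤ c₂ u`
  have hcle : c ≤ c₂ * u := by
    by_contra hlt
    have hlt' : c₂ * u < c := not_le.mp hlt
    have hcpos : 0 < c := lt_of_le_of_lt (mul_nonneg hc₂ hu0) hlt'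
    have h := hbound i₀ j₀
    rw [← hc] at h
    rcases le_max_iff.mp h with h1 | h1
    · exact hlt h1
    · exact absurd h1 (not_le.mpr (mul_lt_of_lt_one_left hcpos hd))
  intro i j
  exact (hTc i j).trans hcle

/-! ### Berger–Colmez, Prop. 3.2.6 over the datum: one coboundary decompletes the whole cocycle -/

/-- ★★ **Sen's decompletion of a cocycle over a Tate–Sen datum (Berger–Colmez Prop. 3.2.6).** Let the
closed subfield `A ⊆ ℂ_F`, `γ ∈ G₀` (`γA ⊆ A`) and `R` satisfy: on `A`, `R` is an additive idempotent with
`γ`-fixed values in `A`, linear over the `γ`-invariants, `R ∘ γ = R`, (TS2) `‖R x‖ ≤ ‖p‖^{-k₂}‖x‖`,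
(TS3) `‖x − R x‖ ≤ ‖p‖^{-k₃}‖γx − x‖`, and `γ − 1` maps `ker R` onto itself. Let `U_γ ∈ M_d(A)` with
`‖U_γ − 1‖ ≤ ‖p‖^{2k₂+2k₃+1}`. Then there is `B ∈ GL_d(A)` with `‖B − 1‖ ≤ ‖p‖^{k₂+1}`, `B⁻¹ ∈ M_d(A)`,
such that `W = B⁻¹ U_γ γ(B) ∈ M_d(A)` is fixed by `γ` entrywise with `‖W − 1‖ ≤ ‖p‖^{k₂+2k₃+1}`, and
such that for every `τ ∈ G₀` preserving `A` and commuting with `γ` on `A` and every `U_τ ∈ M_d(A)` with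
`U_γ · γ(U_τ) = U_τ · τ(U_γ)`, the matrix `B⁻¹ U_τ τ(B)` is fixed by `γ` entrywise as well.
[cite: BergerColmez2008, Prop. 3.2.6] [cite: Sen1980, Theorem 3] [cite: Tate1967, §3.3] -/
theorem exists_matrix_conj_fixed_forall_subfield {A : Subfield (CompletedAlgClosure F)}
    (hAc : IsClosed (A : Set (CompletedAlgClosure F)))
    {γ : BaseGaloisGroup hp} {R : CompletedAlgClosure F → CompletedAlgClosure F} {k₂ k₃ : ℕ}
    (hγA : ∀ x ∈ A, γ • x ∈ A) (hRA : ∀ x ∈ A, R x ∈ A) (hγR : ∀ x ∈ A, γ • R x = R x)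
    (hRR : ∀ x ∈ A, R (R x) = R x) (hRsub : ∀ x ∈ A, ∀ y ∈ A, R (x - y) = R x - R y)
    (hRmul : ∀ a ∈ A, ∀ x ∈ A, γ • a = a → R (a * x) = a * R x)
    (hRγ : ∀ x ∈ A, R (γ • x) = R x)
    (hR₂ : ∀ x ∈ A, ‖R x‖ ≤ ‖(p : PadicBase F p hp)‖⁻¹ ^ k₂ * ‖x‖)
    (hR₃ : ∀ x ∈ A, ‖x - R x‖ ≤ ‖(p : PadicBase F p hp)‖⁻¹ ^ k₃ * ‖γ • x - x‖)
    (hRsurj : ∀ v ∈ A, R v = 0 → ∃ c ∈ A, R c = 0 ∧ γ • c - c = v)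
    {Uγ : Matrix m m (CompletedAlgClosure F)} (hUγ : ∀ i j, Uγ i j ∈ A)
    (hUγ1 : ∀ i j, ‖(Uγ - 1) i j‖ ≤ ‖(p : PadicBase F p hp)‖ ^ (2 * k₂ + 2 * k₃ + 1)) :
    ∃ B : Matrix m m (CompletedAlgClosure F), (∀ i j, B i j ∈ A) ∧
      (∀ i j, ‖(B - 1) i j‖ ≤ ‖(p : PadicBase F p hp)‖ ^ (k₂ + 1)) ∧ IsUnit B.det ∧
      (∀ i j, B⁻¹ i j ∈ A) ∧
      (∀ i j, (B⁻¹ * Uγ * B.map fun x => γ • x) i j ∈ A) ∧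
      (∀ i j, γ • (B⁻¹ * Uγ * B.map fun x => γ • x) i j = (B⁻¹ * Uγ * B.map fun x => γ • x) i j) ∧
      (∀ i j, ‖((B⁻¹ * Uγ * B.map fun x => γ • x) - 1) i j‖ ≤
        ‖(p : PadicBase F p hp)‖ ^ (k₂ + 2 * k₃ + 1)) ∧
      ∀ (τ : BaseGaloisGroup hp), (∀ x ∈ A, τ • x ∈ A) → (∀ x ∈ A, γ • τ • x = τ • γ • x) →
        ∀ Uτ : Matrix m m (CompletedAlgClosure F), (∀ i j, Uτ i j ∈ A) →
        Uγ * (Uτ.map fun x => γ • x) = Uτ * (Uγ.map fun x => τ • x) →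
        ∀ i j, γ • (B⁻¹ * Uτ * B.map fun x => τ • x) i j = (B⁻¹ * Uτ * B.map fun x => τ • x) i j := by
  set π : ℝ := ‖(p : PadicBase F p hp)‖ with hπ
  have hπ0 : 0 < π := norm_pos_iff.mpr (by exact_mod_cast (Fact.out : p.Prime).ne_zero)
  have hπ1 : π < 1 := PadicBase.norm_p_lt_one hp
  have hπne : π ≠ 0 := hπ0.ne'
  have hc₂ : 0 ≤ π⁻¹ ^ k₂ := pow_nonneg (inv_nonneg.mpr hπ0.le) _
  have hc₃ : 0 ≤ π⁻¹ ^ k₃ := pow_nonneg (inv_nonneg.mpr hπ0.le) _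
  obtain ⟨B, hBA, hB1, hdet, hBinvA, hWA, hγW⟩ :=
    exists_matrix_conj_fixed_subfield hp hAc hγA hRA hγR hRR hRsub hR₂ hR₃ hRsurj hUγ hUγ1
  -- the a-priori bound: `‖W − 1‖ ≤ π^{-k₂} π^{2k₂+2k₃+1} = π^{k₂+2k₃+1}`
  have hBW : B * (B⁻¹ * Uγ * B.map fun x => γ • x) = Uγ * B.map fun x => γ • x := by
    rw [Matrix.mul_assoc, Matrix.mul_nonsing_inv_cancel_left B _ hdet]
  have hd : π⁻¹ ^ k₂ * π ^ (k₂ + 1) < 1 := by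
    rw [inv_pow, pow_succ, ← mul_assoc, inv_mul_cancel₀ (pow_ne_zero _ hπne), one_mul]; exact hπ1
  have hd1 : π ^ (k₂ + 1) ≤ 1 := pow_le_one₀ hπ0.le hπ1.le
  have hW1 : ∀ i j, ‖((B⁻¹ * Uγ * B.map fun x => γ • x) - 1) i j‖ ≤ π ^ (k₂ + 2 * k₃ + 1) := by
    intro i j
    have h := norm_fixed_conj_sub_one_le_subfield hp hγA hRsub hRmul hRγ hc₂ hR₂ hR₃ hBA hUγ hWA hγW
      hBW (pow_nonneg hπ0.le _) hd1 hd (pow_nonneg hπ0.le _) hB1 hUγ1 i j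
    refine h.trans (le_of_eq ?_)
    rw [inv_pow]; field_simp; ring
  refine ⟨B, hBA, hB1, hdet, hBinvA, hWA, hγW, hW1, fun τ hτA hγτ Uτ hUτ hrel => ?_⟩
  -- ring homomorphisms for `γ` and `τ`
  set fγ : CompletedAlgClosure F →+* CompletedAlgClosure F :=
    MulSemiringAction.toRingHom (BaseGaloisGroup hp) (CompletedAlgClosure F) γ with hfγ_def
  have hfγ : (fun x : CompletedAlgClosure F => γ • x) = ⇑fγ := by
    funext x; simp [hfγ_def]
  set fτ : CompletedAlgClosure F →+* CompletedAlgClosure F :=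
    MulSemiringAction.toRingHom (BaseGaloisGroup hp) (CompletedAlgClosure F) τ with hfτ_def
  have hfτ : (fun x : CompletedAlgClosure F => τ • x) = ⇑fτ := by
    funext x; simp [hfτ_def]
  -- `γ τ = τ γ` entrywise on matrices over `A`
  have hcomm : ∀ {M : Matrix m m (CompletedAlgClosure F)}, (∀ i j, M i j ∈ A) →
      (M.map ⇑fτ).map ⇑fγ = (M.map ⇑fγ).map ⇑fτ := by
    intro M hM
    have h := map_map_comm_of_memA hp A hγτ hM
    rwa [hfγ, hfτ] at h
  have hcancel : ∀ (g : CompletedAlgClosure F →+* CompletedAlgClosure F), B.map ⇑g * B⁻¹.map ⇑g = 1 := by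
    intro g
    rw [← Matrix.map_mul, Matrix.mul_nonsing_inv B hdet, Matrix.map_one g (map_zero g) (map_one g)]
  have hVA : ∀ i j, (B⁻¹ * Uτ * B.map fun x => τ • x) i j ∈ A :=
    mul_apply_memA A (mul_apply_memA A hBinvA hUτ) (map_smul_apply_memA hp A hτA hBA)
  -- `W γ(V) = V τ(W)`
  have hrel' : Uγ * Uτ.map ⇑fγ = Uτ * Uγ.map ⇑fτ := by rw [← hfγ, ← hfτ]; exact hrel
  have hWV : (B⁻¹ * Uγ * B.map ⇑fγ) * (B⁻¹ * Uτ * B.map ⇑fτ).map ⇑fγ =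
      (B⁻¹ * Uτ * B.map ⇑fτ) * (B⁻¹ * Uγ * B.map ⇑fγ).map ⇑fτ := by
    rw [Matrix.map_mul, Matrix.map_mul, Matrix.map_mul, Matrix.map_mul, hcomm hBA]
    calc B⁻¹ * Uγ * B.map ⇑fγ * (B⁻¹.map ⇑fγ * Uτ.map ⇑fγ * (B.map ⇑fγ).map ⇑fτ)
        = B⁻¹ * Uγ * (B.map ⇑fγ * B⁻¹.map ⇑fγ) * Uτ.map ⇑fγ * (B.map ⇑fγ).map ⇑fτ := by noncomm_ring
      _ = B⁻¹ * (Uγ * Uτ.map ⇑fγ) * (B.map ⇑fγ).map ⇑fτ := by rw [hcancel fγ]; noncomm_ring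
      _ = B⁻¹ * (Uτ * Uγ.map ⇑fτ) * (B.map ⇑fγ).map ⇑fτ := by rw [hrel']
      _ = B⁻¹ * Uτ * (B.map ⇑fτ * B⁻¹.map ⇑fτ) * Uγ.map ⇑fτ * (B.map ⇑fγ).map ⇑fτ := by
          rw [hcancel fτ]; noncomm_ring
      _ = B⁻¹ * Uτ * B.map ⇑fτ * (B⁻¹.map ⇑fτ * Uγ.map ⇑fτ * (B.map ⇑fγ).map ⇑fτ) := by noncomm_ring
  -- `W` is invertible (`‖W − 1‖ ≤ π^{k₂+2k₃+1} < 1`), so `γ(V) = W⁻¹ V τ(W)`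
  have hr1 : π ^ (k₂ + 2 * k₃ + 1) < 1 := pow_lt_one₀ hπ0.le hπ1 (by omega)
  have hr : π⁻¹ ^ k₃ * π ^ (k₂ + 2 * k₃ + 1) < 1 := by
    have h : π⁻¹ ^ k₃ * π ^ (k₂ + 2 * k₃ + 1) = π ^ (k₂ + k₃ + 1) := by
      rw [inv_pow]; field_simp; ring
    rw [h]; exact pow_lt_one₀ hπ0.le hπ1 (by omega)
  have hW1' : ∀ i j, ‖((B⁻¹ * Uγ * B.map ⇑fγ) - 1) i j‖ ≤ π ^ (k₂ + 2 * k₃ + 1) := by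
    rw [← hfγ]; exact hW1
  obtain ⟨hdetW, -⟩ := isUnit_det_and_norm_inv_sub_one_le (pow_nonneg hπ0.le _) hr1 hW1'
  have hγV : (B⁻¹ * Uτ * B.map ⇑fτ).map ⇑fγ =
      (B⁻¹ * Uγ * B.map ⇑fγ)⁻¹ * (B⁻¹ * Uτ * B.map ⇑fτ) * (B⁻¹ * Uγ * B.map ⇑fγ).map ⇑fτ := by
    have h : (B⁻¹ * Uγ * B.map ⇑fγ)⁻¹ * ((B⁻¹ * Uγ * B.map ⇑fγ) * (B⁻¹ * Uτ * B.map ⇑fτ).map ⇑fγ) =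
        (B⁻¹ * Uγ * B.map ⇑fγ)⁻¹ * ((B⁻¹ * Uτ * B.map ⇑fτ) * (B⁻¹ * Uγ * B.map ⇑fγ).map ⇑fτ) := by
      rw [hWV]
    rwa [Matrix.nonsing_inv_mul_cancel_left _ _ hdetW, ← Matrix.mul_assoc] at h
  -- apply the propagation lemma with `r = π^{k₂+2k₃+1}`
  have hWA' : ∀ i j, (B⁻¹ * Uγ * B.map ⇑fγ) i j ∈ A := by rw [← hfγ]; exact hWA
  have hγW' : ∀ i j, γ • (B⁻¹ * Uγ * B.map ⇑fγ) i j = (B⁻¹ * Uγ * B.map ⇑fγ) i j := by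
    rw [← hfγ]; exact hγW
  have hVA' : ∀ i j, (B⁻¹ * Uτ * B.map ⇑fτ) i j ∈ A := by rw [← hfτ]; exact hVA
  have hγV' : ((B⁻¹ * Uτ * B.map ⇑fτ).map fun x => γ • x) =
      (B⁻¹ * Uγ * B.map ⇑fγ)⁻¹ * (B⁻¹ * Uτ * B.map ⇑fτ) *
        (B⁻¹ * Uγ * B.map ⇑fγ).map fun x => τ • x := by
    rw [hfγ, hfτ]; exact hγV
  have h := matrix_smul_eq_of_map_eq_inv_mul_map_subfield hp hRA hγR hRR hRsub hRmul hRγ hc₃ hR₃ hτA hγτ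
    hWA' hγW' hr1 hr hW1' hVA' hγV'
  rw [hfτ]
  exact h

end TateTrace

end Literature.NumberTheory.PAdicHodge
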